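import Summits.NavierStokesRegularity.NavierStokesRegularity.Theorems.GaldiLiouvilleGateCylinderBudgetsDefs
import Summits.NavierStokesRegularity.NavierStokesRegularity.Theorems.GaldiLiouvilleGateAxisymGaldiLiouvilleSwirlTailVanish
import Summits.NavierStokesRegularity.NavierStokesRegularity.Theorems.GaldiLiouvilleGateAxisymGaldiLiouvilleAxialRigidity
import Summits.NavierStokesRegularity.NavierStokesRegularity.Theorems.GaldiLiouvilleGateGaldiLiouvilleAxialRigidity
import Summits.NavierStokesRegularity.NavierStokesRegularity.Theorems.GaldiLiouvilleGateGaldiLiouvilleHeadMaximumPrinciple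

/-!
# GaldiLiouvilleGateCylinderBudgetsAssembly — census rows S1 ⟨0895⟩ (line «allaxes») and S3 ⟨0896⟩ (line «cylbudget»):
# the landed pieces plugged into the Defs of record BY `exact`, and the kernel-checked compositions (RUNG + item) BY NAME

Lane RUNG/DEFS assembler ns-s29-p2 g3 (arbiter ns-in-ser-a g2 11:45:36Z (2); DIRECTOR-NS #214 (2) lane picture).  Texts:
`Theorems/GaldiLiouvilleGateCylinderBudgetsDefs.lean` (= ns-idea-4 combined v3.1 817120c4c833a18a).  This file contains NO new
mathematics: every `_holds` theorem is `exact <a landed piece>` and every composition is v3.1's kernel-checked glue VERBATIM.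

LANDED PIECES PLUGGED (all `--supports stmt-NavierStokesRegularity-0895 --as helper` or `…-0896`):
* O3 `SwirlEnergyTailVanish` ← `AxisymGaldiLiouville.CylinderBudget.swirlEnergyTailVanish` (nsreg-C26-p1 g4, p626391; the text
  has no symmetry hypothesis, so it serves both lines);
* O2 `AxialRigidity` (general) ← `GaldiLiouville.AllAxesBudget.axialRigidity` (ns-s29-p2 g3, p629569 + p628574);
  O2 axisym ← `AxisymGaldiLiouville.CylinderBudget.axialRigidity` (C26-p1, p626924) and, a second time, from the general one;
* O1b″ ← `GaldiLiouville.AllAxesBudget.headMaximumPrinciple_of_pressureLimit` (ns-in-wu-con g2, p630308): the pressure-limit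
  fact shape `∃ c, P → c` (O1b′, Galdi X.5.1 = tree fact `wang2025_thm21_DSolution_uniformDecay`, ns-in-wu-p33 g2) ⇒ O1b.
STILL OPEN (hypotheses below, not stubs): O1a `PressureHessianIntegrable` (Literature-fact-shaped, wu-p33), O1b′ (pressure
limit), O1a″ `CylinderDecayOfHessian` (wu-p33), O1c′ `CylinderBookkeepingSplit` (ser-a: p628250, p629261, p629668, …), and the
cruxes K2/K1 of each line (HoopTailFinite/HoopTailCritical; SwirlMomentGain/SwirlTailCritical) — NOT touched here.

RUNGS BY NAME, modulo exactly the open O1 pieces: `hoopEnergyLiouville_of_cylinderBudget : CylinderBudget → HoopEnergyLiouville`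
(«u_θ ∈ L² about one axis ⇒ U ≡ 0», general), `hoopEnergyLiouville_of_split` (from O1a, O1b′, O1a″, O1c′), and the ⟨0896⟩ twins
`finiteSwirlEnergyLiouville_of_cylinderBudget` / `_of_split`.  The proof-of-item compositions `GaldiLiouville_of` /
`AxisymGaldiLiouville_of` are v3.1's (conditional on the cruxes; nothing closes).

WHAT THIS IS NOT: no summit, no ⟨0895⟩/⟨0896⟩ claim and no NS-regularity statement is proved; the rungs are CONDITIONAL on the
open O1 pieces named above until those land (each later landing = a one-line `exact` append to this file).
-/

noncomputable section

open MeasureTheory Set Filter Topology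
open scoped ENNReal
open Literature.Analysis.FluidPDE

set_option linter.dupNamespace false

/-! ## §1 — ⟨0895⟩ `GaldiLiouville`, line allaxes -/

namespace Summit.NavierStokesRegularity.NavierStokesRegularity.Theorems.GaldiLiouville.AllAxesBudget

/-- **O3 holds** (nsreg-C26-p1 g4, p626391 — the cylbudget file's theorem IS the general text). -/
theorem swirlEnergyTailVanish_holds : SwirlEnergyTailVanish :=
  AxisymGaldiLiouville.CylinderBudget.swirlEnergyTailVanish

/-- **O2 holds, general form** (ns-s29-p2 g3, p629569: no symmetry, no pressure-limit fact). -/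
theorem axialRigidity_holds : AxialRigidity := axialRigidity

/-- **O1b from the pressure-limit fact shape O1b′** (ns-in-wu-con g2, p630308: head maximum principle by the drift maximum
principle of p628574). -/
theorem headMaximumPrinciple_of_pressureLimit'
    (hlimit : ∀ ν : ℝ, 0 < ν → ∀ (U : EuclideanSpace ℝ (Fin 3) → EuclideanSpace ℝ (Fin 3)) (P : EuclideanSpace ℝ (Fin 3) → ℝ), IsDSolution ν U P →
      ∃ c : ℝ, Tendsto P (cocompact (EuclideanSpace ℝ (Fin 3))) (𝓝 c)) :
    HeadMaximumPrinciple :=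
  headMaximumPrinciple_of_pressureLimit hlimit


/-- The finer split recomposes O1c (so every composition below is unchanged). -/
theorem cylinderBookkeeping_of_split (h₁ : CylinderDecayOfHessian) (h₂ : CylinderBookkeepingSplit) :
    CylinderBookkeeping :=
  fun ha hb => h₂ (h₁ ha hb) hb

/-- Closing step shared by the line and its rung: budget (O1) + axial rigidity (O2) + a subcritical
swirl tail along a sequence ⇒ `U = 0` (monotonicity of the inner axial energy in the radius +
`a ≤ liminf`). -/
theorem eq_zero_of_liminf_swirlTail (h₁ : CylinderBudget) (h₂ : AxialRigidity) {ν : ℝ} (hν : 0 < ν)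
    {U : EuclideanSpace ℝ (Fin 3) → EuclideanSpace ℝ (Fin 3)} {P : EuclideanSpace ℝ (Fin 3) → ℝ} (hsol : IsDSolution ν U P)
    (hli : Filter.liminf (fun t : ℝ => ENNReal.ofReal (t ^ 2) * swirlTail U t) atTop = 0) :
    U = 0 := by
  refine h₂ ν hν U P hsol (fun t₀ ht₀ => ?_)
  have hev : ∀ᶠ t in atTop, axialEnergyIn U t₀ ≤ ENNReal.ofReal (t ^ 2) * swirlTail U t := by
    filter_upwards [eventually_ge_atTop t₀] with t ht
    calc axialEnergyIn U t₀ ≤ axialEnergyIn U t :=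
          lintegral_mono_set (fun x (hx : cylRadius x ≤ t₀) => le_trans hx ht)
      _ ≤ ENNReal.ofReal (t ^ 2) * swirlTail U t := h₁ ν hν U P hsol t (lt_of_lt_of_le ht₀ ht)
  have hle : axialEnergyIn U t₀ ≤
      Filter.liminf (fun t : ℝ => ENNReal.ofReal (t ^ 2) * swirlTail U t) atTop :=
    Filter.le_liminf_of_le (h := hev)
  exact le_antisymm (hli ▸ hle) bot_le

/-- On the outer cylinder `{r > t}`, `t > 0`: `t² (u_θ/r)² ≤ u_θ²`, integrated. -/
theorem sq_mul_swirlTail_le {U : EuclideanSpace ℝ (Fin 3) → EuclideanSpace ℝ (Fin 3)} {t : ℝ} (ht : 0 < t) :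
    ENNReal.ofReal (t ^ 2) * swirlTail U t ≤
      ∫⁻ x in {x : EuclideanSpace ℝ (Fin 3) | t < cylRadius x}, ENNReal.ofReal (swirlVelocity U x ^ 2) := by
  have hS : MeasurableSet {x : EuclideanSpace ℝ (Fin 3) | t < cylRadius x} :=
    measurableSet_lt measurable_const continuous_cylRadius.measurable
  unfold swirlTail swirlRateSq
  rw [← lintegral_const_mul' _ _ ENNReal.ofReal_ne_top]
  refine setLIntegral_mono' hS (fun x hx => ?_)
  have hx' : t < cylRadius x := hx
  have hr : 0 < cylRadius x := ht.trans hx'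
  rw [← ENNReal.ofReal_mul (sq_nonneg t)]
  refine ENNReal.ofReal_le_ofReal ?_
  have hq : (t / cylRadius x) ^ 2 ≤ 1 := by
    have h1 : t / cylRadius x ≤ 1 := (div_le_one hr).mpr hx'.le
    have h0 : 0 ≤ t / cylRadius x := div_nonneg ht.le hr.le
    exact pow_le_one₀ h0 h1
  calc t ^ 2 * (swirlVelocity U x / cylRadius x) ^ 2
        = (t / cylRadius x) ^ 2 * swirlVelocity U x ^ 2 := by
          field_simp
    _ ≤ 1 * swirlVelocity U x ^ 2 := by
          exact mul_le_mul_of_nonneg_right hq (sq_nonneg _)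
    _ = swirlVelocity U x ^ 2 := one_mul _

/-- THE RUNG, kernel-checked from O1 + O2 + O3: finite swirl energy ⇒ trivial. -/
theorem hoopEnergyLiouville_of (h₁ : CylinderBudget) (h₂ : AxialRigidity)
    (h₃ : SwirlEnergyTailVanish) : HoopEnergyLiouville := by
  intro ν hν U P hsol hE
  have hU : ContDiff ℝ (⊤ : ℕ∞) U := hsol.2.1
  have htail := h₃ U hU hE
  have hlim : Tendsto (fun t : ℝ => ENNReal.ofReal (t ^ 2) * swirlTail U t) atTop (𝓝 0) := by
    refine tendsto_of_tendsto_of_tendsto_of_le_of_le' tendsto_const_nhds htail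
      (Eventually.of_forall fun t => bot_le) ?_
    filter_upwards [eventually_gt_atTop (0 : ℝ)] with t ht
    exact sq_mul_swirlTail_le ht
  exact eq_zero_of_liminf_swirlTail h₁ h₂ hν hsol hlim.liminf_eq


/-- The line decides S1: `O1a → O1b → O1c → O2 → K2 → K1 → GaldiLiouville` (pure logic over the closing
step; `O1 = O1c O1a O1b`). -/
theorem GaldiLiouville_of (h1a : PressureHessianIntegrable) (h1b : HeadMaximumPrinciple)
    (h1c : CylinderBookkeeping) (h₂ : AxialRigidity) (h₃ : HoopTailFinite)
    (h₄ : HoopTailCritical) : Theses.GaldiLiouvilleGate.GaldiLiouville := by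
  intro ν hν U P hprof hU hP hD hlim
  have hsol : IsDSolution ν U P := ⟨hprof, hU, hP, hD, hlim⟩
  exact eq_zero_of_liminf_swirlTail (h1c h1a h1b) h₂ hν hsol (h₄ ν hν U P hsol (h₃ ν hν U P hsol))


/-- **RUNG modulo O1**: the all-axes budget alone now gives «u_θ ∈ L² about one axis ⇒ U ≡ 0» (O2, O3 landed). -/
theorem hoopEnergyLiouville_of_cylinderBudget (h₁ : CylinderBudget) : HoopEnergyLiouville :=
  hoopEnergyLiouville_of h₁ axialRigidity_holds swirlEnergyTailVanish_holds

/-- **RUNG modulo the open O1 pieces of the finer split**: O1a (pressure Hessian integrable, fact-shaped), O1b′ (pressure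
limit, fact-shaped), O1a″ (cylinder decay of the Hessian), O1c′ (one-stroke bookkeeping) ⇒ «u_θ ∈ L² ⇒ U ≡ 0». -/
theorem hoopEnergyLiouville_of_split (h1a : PressureHessianIntegrable)
    (h1b' : ∀ ν : ℝ, 0 < ν → ∀ (U : EuclideanSpace ℝ (Fin 3) → EuclideanSpace ℝ (Fin 3)) (P : EuclideanSpace ℝ (Fin 3) → ℝ), IsDSolution ν U P →
      ∃ c : ℝ, Tendsto P (cocompact (EuclideanSpace ℝ (Fin 3))) (𝓝 c))
    (h1a'' : CylinderDecayOfHessian) (h1c' : CylinderBookkeepingSplit) : HoopEnergyLiouville :=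
  hoopEnergyLiouville_of_cylinderBudget
    (cylinderBookkeeping_of_split h1a'' h1c' h1a (headMaximumPrinciple_of_pressureLimit' h1b'))

end Summit.NavierStokesRegularity.NavierStokesRegularity.Theorems.GaldiLiouville.AllAxesBudget

/-! ## §2 — ⟨0896⟩ `AxisymGaldiLiouville`, line cylbudget -/

namespace Summit.NavierStokesRegularity.NavierStokesRegularity.Theorems.AxisymGaldiLiouville.CylinderBudget

open Summit.NavierStokesRegularity.NavierStokesRegularity.Theorems.GaldiLiouville
open Summit.NavierStokesRegularity.NavierStokesRegularity.Theorems.GaldiLiouville.AllAxesBudget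

/-- An axisymmetric D-solution is a D-solution (forget the symmetry). -/
theorem IsAxisymDSolution.toIsDSolution {ν : ℝ} {U : EuclideanSpace ℝ (Fin 3) → EuclideanSpace ℝ (Fin 3)} {P : EuclideanSpace ℝ (Fin 3) → ℝ}
    (h : IsAxisymDSolution ν U P) : IsDSolution ν U P :=
  ⟨h.1, h.2.2.1, h.2.2.2.1, h.2.2.2.2.1, h.2.2.2.2.2⟩


/-- The general all-axes budget specialises to the axisymmetric class. -/
theorem cylinderBudget_of_general (h : AllAxesBudget.CylinderBudget) : CylinderBudget :=
  fun ν hν U P hsol t ht => h ν hν U P hsol.toIsDSolution t ht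


/-- General axial rigidity specialises to the axisymmetric class. -/
theorem axialRigidity_of_general (h : AllAxesBudget.AxialRigidity) : AxialRigidity :=
  fun ν hν U P hsol hz => h ν hν U P hsol.toIsDSolution hz


/-- The general hoop-energy Liouville rung specialises to the axisymmetric finite-swirl-energy rung. -/
theorem finiteSwirlEnergyLiouville_of_general (h : AllAxesBudget.HoopEnergyLiouville) :
    FiniteSwirlEnergyLiouville :=
  fun ν hν U P hsol hE => h ν hν U P hsol.toIsDSolution hE


/-! ### Compositions for ⟨0896⟩ -/

/-- Closing step in the axisymmetric class from the axisymmetric special forms of O1, O2. -/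
theorem eq_zero_of_liminf_swirlTail (h₁ : CylinderBudget) (h₂ : AxialRigidity) {ν : ℝ} (hν : 0 < ν)
    {U : EuclideanSpace ℝ (Fin 3) → EuclideanSpace ℝ (Fin 3)} {P : EuclideanSpace ℝ (Fin 3) → ℝ} (hsol : IsAxisymDSolution ν U P)
    (hli : Filter.liminf (fun t : ℝ => ENNReal.ofReal (t ^ 2) * swirlTail U t) atTop = 0) : U = 0 := by
  refine h₂ ν hν U P hsol fun t ht => ?_
  have hev : ∀ᶠ s in atTop, axialEnergyIn U t ≤ ENNReal.ofReal (s ^ 2) * swirlTail U s := by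
    filter_upwards [eventually_ge_atTop t] with s hs
    exact (lintegral_mono_set fun x (hx : cylRadius x ≤ t) => le_trans hx hs).trans
      (h₁ ν hν U P hsol s (lt_of_lt_of_le ht hs))
  have hle : axialEnergyIn U t ≤ Filter.liminf (fun s : ℝ => ENNReal.ofReal (s ^ 2) * swirlTail U s) atTop :=
    Filter.le_liminf_of_le (h := hev)
  exact le_antisymm (hli ▸ hle) bot_le

/-- S3 from the GENERAL supports of §1 and the axisymmetric cruxes (P1′ dedup: land O1a/O1b/O1c/O2 once):
`O1a → O1b → O1c → O2 → K2 → K1 → AxisymGaldiLiouville`. -/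
theorem AxisymGaldiLiouville_of (h1a : AllAxesBudget.PressureHessianIntegrable)
    (h1b : AllAxesBudget.HeadMaximumPrinciple) (h1c : AllAxesBudget.CylinderBookkeeping)
    (h₂ : AllAxesBudget.AxialRigidity) (h₃ : SwirlMomentGain) (h₄ : SwirlTailCritical) :
    Theses.GaldiLiouvilleGate.AxisymGaldiLiouville := by
  intro ν hν U P hprof hax hU hP hD hlim
  have hsol : IsAxisymDSolution ν U P := ⟨hprof, hax, hU, hP, hD, hlim⟩
  exact eq_zero_of_liminf_swirlTail (cylinderBudget_of_general (h1c h1a h1b)) (axialRigidity_of_general h₂)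
    hν hsol (h₄ ν hν U P hsol (h₃ ν hν U P hsol))

/-- Same with the AXISYMMETRIC special forms of O1/O2 (so nsreg-C26-p1's landed axisymmetric `axialRigidity`
counts as is). -/
theorem AxisymGaldiLiouville_of' (h₁ : CylinderBudget) (h₂ : AxialRigidity) (h₃ : SwirlMomentGain)
    (h₄ : SwirlTailCritical) : Theses.GaldiLiouvilleGate.AxisymGaldiLiouville := by
  intro ν hν U P hprof hax hU hP hD hlim
  have hsol : IsAxisymDSolution ν U P := ⟨hprof, hax, hU, hP, hD, hlim⟩
  exact eq_zero_of_liminf_swirlTail h₁ h₂ hν hsol (h₄ ν hν U P hsol (h₃ ν hν U P hsol))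

/-- **O2-axisym holds** (nsreg-C26-p1 g4, p626924; also `axialRigidity_of_general axialRigidity_holds`). -/
theorem axialRigidity_holds : AxialRigidity := axialRigidity

/-- **RUNG ⟨0896⟩ modulo O1**: finite swirl energy ⇒ trivial, for axisymmetric D-solutions. -/
theorem finiteSwirlEnergyLiouville_of_cylinderBudget (h₁ : AllAxesBudget.CylinderBudget) : FiniteSwirlEnergyLiouville :=
  finiteSwirlEnergyLiouville_of_general (AllAxesBudget.hoopEnergyLiouville_of_cylinderBudget h₁)

/-- **RUNG ⟨0896⟩ modulo the open O1 pieces of the finer split.** -/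
theorem finiteSwirlEnergyLiouville_of_split (h1a : AllAxesBudget.PressureHessianIntegrable)
    (h1b' : ∀ ν : ℝ, 0 < ν → ∀ (U : EuclideanSpace ℝ (Fin 3) → EuclideanSpace ℝ (Fin 3)) (P : EuclideanSpace ℝ (Fin 3) → ℝ), AllAxesBudget.IsDSolution ν U P →
      ∃ c : ℝ, Tendsto P (cocompact (EuclideanSpace ℝ (Fin 3))) (𝓝 c))
    (h1a'' : AllAxesBudget.CylinderDecayOfHessian) (h1c' : AllAxesBudget.CylinderBookkeepingSplit) :
    FiniteSwirlEnergyLiouville :=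
  finiteSwirlEnergyLiouville_of_general (AllAxesBudget.hoopEnergyLiouville_of_split h1a h1b' h1a'' h1c')

end Summit.NavierStokesRegularity.NavierStokesRegularity.Theorems.AxisymGaldiLiouville.CylinderBudget

end
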